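import Summits.CriticalPhenomena.CardyFormulaZ2.Theorems.CardyBoundaryCoulombGasHalfPlaneMarkDensityLawNoFreeConstant

/-!
# `HalfPlaneMarkDensityLaw` (crux stmt-CriticalPhenomena-5661), line `Sketch`, wired duality:
# stub `stub_wired_of_jointLimit` (W1) — along `θ` the wired kernel converges, to
# `W_G(σ,x) = lim_M G(−M, −σ, 1/M, x)`

For a joint subsequential limit `G` of the collinear four-mark crossing probabilities
`P_{θ n}(a,b,c,y)` along a strictly increasing `θ`, and `σ, x > 0`:

* the lower comparison values `ℓ M := G(−M, −σ, 1/M, x)` are nondecreasing in `M` (both arcs grow,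
  `Subseq.jointLimit_mono`) and bounded by `1` (`Subseq.jointLimit_mem_Icc`), so they converge to
  some `W`;
* the upper comparison values `u M := G(−M, −σ + 1/M, 0, x)` satisfy
  `ℓ M ≤ u M ≤ ℓ M + 4C(8 M⁻¹/(σ − M⁻¹))^α` (the `δ`-move bound `Subseq.jointLimit_move_le` with
  `δ = 1/M`), so `u M → W` as well;
* the wired three-mark kernel `P_{θ n}[(−∞,−⌊σ θn⌋]×{0} ↔ [1,⌊x θn⌋]×{0} in ℤ×ℕ]` is sandwiched at
  every fixed `M` between `P_{θ n}(−M,−σ,1/M,x)` (`WiredCardy.le_wired`) and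
  `P_{θ n}(−M,−σ+1/M,0,x) +` escape (`WiredCardy.wired_le`, `WiredCardy.escape_le'`), whose limits
  along `θ` are `ℓ M` and `u M + C(⌈x⌉/M)^α`; `BoxExhaustion.tendsto_of_sandwich` concludes that the
  wired kernel converges along `θ` to `W` (exactly as in `NoFreeConstant.tendsto_wired_subseq`, with
  no closed formula for the limit).
-/

noncomputable section

namespace Summit.CriticalPhenomena.CardyFormulaZ2.Cruxes.HalfPlaneMarkDensityLaw.SketchLine

open Literature.Probability.Percolation Literature.Probability.LatticeModels
open MeasureTheory Filter Set
open scoped Topology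
open Summit.CriticalPhenomena.CardyFormulaZ2.Theorems.HalfPlaneMarkDensityLaw.Negative

namespace WiredDual

/-- STUB W1: along `θ` the wired kernel converges, to `W_G(σ,x) = lim_M G(−M,−σ,1/M,x)`: the lower
comparison values `G(−M,−σ,1/M,x)` are monotone and bounded (hence converge to some `W`), the upper
ones `G(−M,−σ+1/M,0,x)` differ from them by the `δ`-move error `4C(8M⁻¹/(σ−M⁻¹))^α → 0`, and the
sandwich of `…WiredCardy` run along `θ` gives the convergence of the wired kernel to `W`. [folklore] -/
theorem stub_wired_of_jointLimit :
    ∀ {θ : ℕ → ℕ} {G : ℝ → ℝ → ℝ → ℝ → ℝ},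
      (∀ a b c y : ℝ, a < b → b < c → c < y →
        Tendsto (fun n ↦ μ.real (openCrossing halfPlane (arcA a b (θ n))
          (rowIcc ⌊c * (θ n : ℕ)⌋ ⌊y * (θ n : ℕ)⌋))) atTop (𝓝 (G a b c y))) →
      StrictMono θ → ∀ σ x : ℝ, 0 < σ → 0 < x → ∃ W : ℝ,
        Tendsto (fun M : ℕ ↦ G (-(M : ℝ)) (-σ) ((M : ℝ)⁻¹) x) atTop (𝓝 W) ∧
        Tendsto (fun n ↦ μ.real (openCrossing halfPlane {v : Site 2 | v 1 = 0 ∧ v 0 ≤ -⌊σ * (θ n : ℕ)⌋} {v : Site 2 | v 1 = 0 ∧ 1 ≤ v 0 ∧ v 0 ≤ ⌊x * (θ n : ℕ)⌋})) atTop (𝓝 W) := by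
  intro θ G hG hθ σ x hσ hx
  obtain ⟨C, α, hC0, hα, hesc⟩ := exists_real_boxToFar_le_rpow_of_le_half
  -- thresholds in `M`: for `M ≥ M₀` both comparison configurations lie in the chamber
  have e4 : ∀ᶠ M : ℕ in atTop, (M : ℝ)⁻¹ < min (σ / 11) x :=
    (tendsto_inv_atTop_nhds_zero_nat (𝕜 := ℝ)) (Iio_mem_nhds (lt_min (by positivity) hx))
  have e5 : ∀ᶠ M : ℕ in atTop, σ < M := (tendsto_natCast_atTop_atTop (R := ℝ)).eventually_gt_atTop σ
  obtain ⟨M₀, hM₀⟩ := eventually_atTop.1 (e4.and e5)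
  have hσM : ∀ M ≥ M₀, σ < M := fun M hM ↦ (hM₀ M hM).2
  have hpos : ∀ M ≥ M₀, (0 : ℝ) < M := fun M hM ↦ hσ.trans (hσM M hM)
  have hinvσ : ∀ M ≥ M₀, 11 * (M : ℝ)⁻¹ < σ := fun M hM ↦ by
    have := lt_of_lt_of_le (hM₀ M hM).1 (min_le_left _ _)
    linarith
  have hinvx : ∀ M ≥ M₀, (M : ℝ)⁻¹ < x := fun M hM ↦ lt_of_lt_of_le (hM₀ M hM).1 (min_le_right _ _)
  set ℓ : ℕ → ℝ := fun M ↦ G (-(M : ℝ)) (-σ) ((M : ℝ)⁻¹) x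
  set u : ℕ → ℝ := fun M ↦ G (-(M : ℝ)) (-σ + (M : ℝ)⁻¹) 0 x
  -- (a) `ℓ` is nondecreasing from `M₀` on and bounded by `1`, hence converges
  have hmono : Monotone fun k : ℕ ↦ ℓ (k + M₀) := by
    refine monotone_nat_of_le_succ fun k ↦ ?_
    have hk : M₀ ≤ k + M₀ := Nat.le_add_left _ _
    have hk' : M₀ ≤ k + 1 + M₀ := Nat.le_add_left _ _
    have h0 := hpos _ hk
    have h0' := hpos _ hk'
    have hcast : ((k + M₀ : ℕ) : ℝ) ≤ ((k + 1 + M₀ : ℕ) : ℝ) := by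
      exact_mod_cast (show k + M₀ ≤ k + 1 + M₀ by omega)
    show ℓ (k + M₀) ≤ ℓ (k + 1 + M₀)
    exact Subseq.jointLimit_mono hG (neg_le_neg hcast) le_rfl (inv_anti₀ h0 hcast) le_rfl
      (by linarith [hσM _ hk]) (by linarith [inv_pos.2 h0]) (hinvx _ hk)
      (by linarith [inv_pos.2 h0'])
  have hbdd : BddAbove (range fun k : ℕ ↦ ℓ (k + M₀)) := by
    refine ⟨1, ?_⟩
    rintro _ ⟨k, rfl⟩
    have hk : M₀ ≤ k + M₀ := Nat.le_add_left _ _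
    have h0 := hpos _ hk
    exact (Subseq.jointLimit_mem_Icc hG (by linarith [hσM _ hk]) (by linarith [inv_pos.2 h0])
      (hinvx _ hk)).2
  set W : ℝ := ⨆ k : ℕ, ℓ (k + M₀)
  have hℓW : Tendsto ℓ atTop (𝓝 W) :=
    (tendsto_add_atTop_iff_nat M₀).1 (tendsto_atTop_ciSup hmono hbdd)
  -- (b) the upper comparison values: `ℓ M ≤ u M ≤ ℓ M + 4C(8M⁻¹/(σ − M⁻¹))^α`, so `u M → W`
  have hgap : Tendsto (fun M : ℕ ↦ (0 : ℝ) - (-σ + (M : ℝ)⁻¹)) atTop (𝓝 σ) := by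
    have h : Tendsto (fun M : ℕ ↦ (0 : ℝ) - (-σ + (M : ℝ)⁻¹)) atTop (𝓝 (0 - (-σ + 0))) :=
      ((tendsto_inv_atTop_nhds_zero_nat (𝕜 := ℝ)).const_add (-σ)).const_sub 0
    rwa [show (0 : ℝ) - (-σ + 0) = σ by ring] at h
  have herr : Tendsto (fun M : ℕ ↦ 4 * (C * (8 * (M : ℝ)⁻¹ / (0 - (-σ + (M : ℝ)⁻¹))) ^ α)) atTop
      (𝓝 0) := by
    have h1 : Tendsto (fun M : ℕ ↦ 8 * (M : ℝ)⁻¹ / (0 - (-σ + (M : ℝ)⁻¹))) atTop (𝓝 (8 * 0 / σ)) :=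
      ((tendsto_inv_atTop_nhds_zero_nat (𝕜 := ℝ)).const_mul 8).div hgap hσ.ne'
    rw [mul_zero, zero_div] at h1
    have h2 := h1.rpow_const (p := α) (Or.inr hα.le)
    rw [Real.zero_rpow hα.ne'] at h2
    have h3 := (h2.const_mul C).const_mul 4
    rw [mul_zero, mul_zero] at h3
    exact h3
  have huW : Tendsto u atTop (𝓝 W) := by
    have hup : Tendsto (fun M : ℕ ↦ ℓ M + 4 * (C * (8 * (M : ℝ)⁻¹ / (0 - (-σ + (M : ℝ)⁻¹))) ^ α))
        atTop (𝓝 W) := by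
      have h := hℓW.add herr
      rwa [add_zero] at h
    refine tendsto_of_tendsto_of_tendsto_of_le_of_le' hℓW hup ?_ ?_
    · filter_upwards [eventually_ge_atTop M₀] with M hM
      have hi0 := inv_pos.2 (hpos M hM)
      exact Subseq.jointLimit_mono hG (a := -(M : ℝ)) (a' := -(M : ℝ)) (b := -σ)
        (b' := -σ + (M : ℝ)⁻¹) (c := (M : ℝ)⁻¹) (c' := 0) (y := x) (y' := x) le_rfl (by linarith)
        hi0.le le_rfl (by linarith [hσM M hM]) (by linarith) (hinvx M hM)
        (by linarith [hinvσ M hM])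
    · filter_upwards [eventually_ge_atTop M₀] with M hM
      have hi0 := inv_pos.2 (hpos M hM)
      exact Subseq.jointLimit_move_le hG hθ hC0.le hα hesc (a := -(M : ℝ)) (a' := -(M : ℝ))
        (b := -σ) (b' := -σ + (M : ℝ)⁻¹) (c := (M : ℝ)⁻¹) (c' := 0) (y := x) (y' := x)
        (δ := (M : ℝ)⁻¹) le_rfl (by linarith) hi0.le le_rfl (by linarith [hσM M hM]) (by linarith)
        (hinvx M hM) (by linarith [hinvσ M hM]) hi0 (by linarith) (by linarith) (by linarith)
        (by linarith) (by linarith [hinvσ M hM])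
  refine ⟨W, hℓW, ?_⟩
  -- (c) the sandwich along `θ`
  have hX : 1 ≤ ⌈x⌉₊ := Nat.one_le_iff_ne_zero.2 (by simpa using hx)
  refine BoxExhaustion.tendsto_of_sandwich fun ε hε ↦ ?_
  have e1 : ∀ᶠ M : ℕ in atTop, W - ε < ℓ M := hℓW (Ioi_mem_nhds (by linarith))
  have e2 : ∀ᶠ M : ℕ in atTop, u M < W + ε := huW (Iio_mem_nhds (by linarith))
  have e3 : ∀ᶠ M : ℕ in atTop, C * ((⌈x⌉₊ : ℝ) / M) ^ α < ε :=
    (WiredCardy.tendsto_escapeBound C hα ⌈x⌉₊) (Iio_mem_nhds hε)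
  obtain ⟨M, hM1, hM2, hM3, hMM₀, hMX⟩ :=
    (e1.and (e2.and (e3.and ((eventually_ge_atTop M₀).and (eventually_ge_atTop ⌈x⌉₊))))).exists
  have hM : 0 < M := lt_of_lt_of_le (by omega) hMX
  have hM' : (0 : ℝ) < M := by exact_mod_cast hM
  have hMσ : (M : ℝ)⁻¹ < σ := by linarith [hinvσ M hMM₀, inv_pos.2 hM']
  have hMx : (M : ℝ)⁻¹ < x := hinvx M hMM₀
  have hσM' : σ < M := hσM M hMM₀
  refine ⟨fun n ↦ μ.real (openCrossing halfPlane (arcA (-(M : ℝ)) (-σ) (θ n))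
      (rowIcc ⌊(M : ℝ)⁻¹ * (θ n : ℕ)⌋ ⌊x * (θ n : ℕ)⌋)),
    fun n ↦ μ.real (openCrossing halfPlane (arcA (-(M : ℝ)) (-σ + (M : ℝ)⁻¹) (θ n))
      (rowIcc ⌊(0 : ℝ) * (θ n : ℕ)⌋ ⌊x * (θ n : ℕ)⌋)), ℓ M, u M,
    hG _ _ _ _ (by linarith) (by linarith [inv_pos.2 hM']) hMx,
    hG _ _ _ _ (by linarith [inv_pos.2 hM']) (by linarith) hx, hM1, hM2, ?_⟩
  filter_upwards [eventually_ge_atTop (max M 1)] with n hn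
  have hn' : max M 1 ≤ θ n := hn.trans (hθ.id_le n)
  have hnM : M ≤ θ n := le_of_max_le_left hn'
  have hn1 : 1 ≤ θ n := le_of_max_le_right hn'
  refine ⟨WiredCardy.le_wired σ x hM hnM, (WiredCardy.wired_le σ x hM hnM).trans ?_⟩
  have := WiredCardy.escape_le' hesc x hX hMX hn1
  linarith

end WiredDual

end Summit.CriticalPhenomena.CardyFormulaZ2.Cruxes.HalfPlaneMarkDensityLaw.SketchLine
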